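import Literature.NumberTheory.EllipticCurves.ModularCurveEtaQuotientsProofs
import HarnessLib

/-!
# `η`-quotients with QUADRATIC CHARACTER: Newman's criterion without the square condition
(route `ManinLocalTwoThree`, crux C2 `ManinOddAtFour` stmt-BirchSwinnertonDyer-22967; cell bsd-f2-manin, prover p3 gen 19; the ANCHOR FORMS of the
kernel port of E-an-152d: rational nowhere-vanishing forms carrying a prescribed even quadratic character of `Γ₀(N)`)

The tree's `etaQuotient_SL2_smul_of_odd` (Newman 1959 / Gordon–Hughes–Newman, trivial character) assumes `∏ δ^{|r_δ|}` is a square.  Dropping that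
condition, the same computation with the Petersson–Knopp multiplier (`etaMultiplier_of_odd_d`) gives the CHARACTER FORM: for `f = ∏_{δ ∣ N} η(δτ)^{r_δ}`
with `Σ r_δ = 2k`, `k` even, `Σ δ r_δ ≡ Σ (N/δ) r_δ ≡ 0 (mod 24)`, and `γ = (a b; c d) ∈ Γ₀(N)` with `d` odd,
`f(γτ) = [∏_δ (δ/|d|)^{r_δ}]·(cτ + d)^k f(τ)` — a Jacobi-symbol character.
* `jacobi_prod_eq` — the Jacobi part of the multiplier product: `∏ (c_δ/|d|)^{r_δ} = ∏ (δ/|d|)^{r_δ}` (`c = δc_δ`, `(c/|d|)^{2k} = 1`);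
* `etaQuotient_SL2_smul_jacobiProd` — the law for `c > 0`, `d` odd; `etaQuotient_smul_jacobiProd_of_mem_Gamma0` — for every `γ ∈ Γ₀(N)` at EVEN
  level `N` (`d` is then odd; `c < 0` via `−γ`, `c = 0` via `±Tⁿ`); `etaQuotient_slash_jacobiProd` — slash form.
HONEST FRAMING: classical bookkeeping (Newman 1959; Ono, Web of Modularity Thm. 1.64); nothing about Manin constants, C2 or BSD is proved here.  No definitions,
no sorry. [cite: Newman1959] [cite: Savitt2025, Thm. 1] [cite: Knopp1970, Ch. 4, Thm. 2]
-/

set_option autoImplicit false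
-- lint-debt: the directory name repeats the summit name (sibling precedent `ManinLocalTwoThreeCDivisionGaloisEngine.lean`)
set_option linter.dupNamespace false

noncomputable section

open UpperHalfPlane hiding I
open ModularForm Complex Matrix.SpecialLinearGroup Filter Asymptotics CongruenceSubgroup
open scoped MatrixGroups Real ModularForm CongruenceSubgroup Topology Manifold NumberTheorySymbols
open Literature.NumberTheory.EllipticCurves.ModularForms

namespace Summit.BirchSwinnertonDyer.BirchSwinnertonDyer.Theorems.ManinLocalTwoThree.EtaAnchor

/-! ## §1 The Jacobi part of the multiplier product -/

/-- **The Jacobi part without the square condition**: for `gcd(c, d) = 1`, `d` odd, `N ∣ c`, `Σ r_δ = 2k` and `c = δ·c_δ`: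
`∏_δ (c_δ/|d|)^{r_δ} = ∏_δ (δ/|d|)^{r_δ}` (`(c_δ/|d|) = (c/|d|)(δ/|d|)` and `(c/|d|)^{2k} = 1`). [folklore] -/
theorem jacobi_prod_eq (N : ℕ) (r : ℕ → ℤ) (k : ℤ) (hk : ∑ δ ∈ N.divisors, r δ = 2 * k)
    (c d : ℤ) (hNc : (N : ℤ) ∣ c) (hcop : IsCoprime c d) (hd : Odd d) (cδ : ℕ → ℤ) (hcδ : ∀ δ ∈ N.divisors, c = δ * cδ δ) :
    ∏ δ ∈ N.divisors, ((J(cδ δ | d.natAbs) : ℤ) : ℂ) ^ (r δ) = ∏ δ ∈ N.divisors, ((J((δ : ℤ) | d.natAbs) : ℤ) : ℂ) ^ (r δ) := by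
  set m := d.natAbs with hm
  have hmodd : Odd m := Int.natAbs_odd.mpr hd
  haveI : NeZero m := ⟨fun h ↦ by rw [h] at hmodd; exact absurd hmodd (by decide)⟩
  have hcg : c.gcd m = 1 := by
    have : Int.gcd c d = 1 := Int.isCoprime_iff_gcd_eq_one.mp hcop
    simpa [Int.gcd, hm, Int.natAbs_abs] using this
  have hu : J(c | m) * J(c | m) = 1 := by
    rcases jacobiSym.eq_one_or_neg_one hcg with h | h <;> rw [h] <;> norm_num
  have hδcop : ∀ δ ∈ N.divisors, IsCoprime (δ : ℤ) d := fun δ hδ ↦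
    hcop.of_isCoprime_of_dvd_left ((Int.natCast_dvd_natCast.mpr (Nat.dvd_of_mem_divisors hδ)).trans hNc)
  have hw : ∀ δ ∈ N.divisors, J((δ : ℤ) | m) * J((δ : ℤ) | m) = 1 := fun δ hδ ↦ by
    have hg : (δ : ℤ).gcd m = 1 := by
      have := Int.isCoprime_iff_gcd_eq_one.mp (hδcop δ hδ)
      simpa [Int.gcd, hm, Int.natAbs_abs] using this
    rcases jacobiSym.eq_one_or_neg_one hg with h | h <;> rw [h] <;> norm_num
  have hfac : ∀ δ ∈ N.divisors, J(cδ δ | m) = J(c | m) * J((δ : ℤ) | m) := fun δ hδ ↦ by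
    have : J(c | m) = J((δ : ℤ) | m) * J(cδ δ | m) := by rw [hcδ δ hδ, jacobiSym.mul_left]
    rw [this]
    linear_combination (-J(cδ δ | m)) * hw δ hδ
  rw [Finset.prod_congr rfl fun δ hδ ↦ by rw [hfac δ hδ]]
  simp_rw [Int.cast_mul, mul_zpow, Finset.prod_mul_distrib]
  have huC : ((J(c | m) : ℤ) : ℂ) * ((J(c | m) : ℤ) : ℂ) = 1 := by exact_mod_cast hu
  have h1 : ∏ δ ∈ N.divisors, ((J(c | m) : ℤ) : ℂ) ^ (r δ) = 1 := by
    have hne : ((J(c | m) : ℤ) : ℂ) ≠ 0 := fun h ↦ by rw [h, zero_mul] at huC; exact zero_ne_one huC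
    rw [show (∏ δ ∈ N.divisors, ((J(c | m) : ℤ) : ℂ) ^ (r δ)) = ((J(c | m) : ℤ) : ℂ) ^ (∑ δ ∈ N.divisors, r δ) by
      induction N.divisors using Finset.induction_on with
      | empty => simp
      | insert a s ha ih => rw [Finset.prod_insert ha, Finset.sum_insert ha, ih, zpow_add₀ hne],
      hk, two_mul, zpow_add₀ hne, ← mul_zpow, huC, one_zpow]
  rw [h1, one_mul]

/-! ## §2 The transformation law with the Jacobi-symbol character -/

/-- **Newman's criterion with quadratic character, core case** (`c > 0`, `d` odd, `N ∣ c`): for `Σ r_δ = 2k`, `k` even and Newman's two congruences,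
`f(γτ) = [∏_δ (δ/|d|)^{r_δ}]·(cτ + d)^k·f(τ)`. [cite: Newman1959] [cite: Knopp1970, Ch. 4, Thm. 2] -/
theorem etaQuotient_SL2_smul_jacobiProd (N : ℕ) (hN : 0 < N) (r : ℕ → ℤ) (k : ℤ) (hkeven : Even k)
    (hk : ∑ δ ∈ N.divisors, r δ = 2 * k)
    (h1 : (24 : ℤ) ∣ ∑ δ ∈ N.divisors, (δ : ℤ) * r δ)
    (h2 : (24 : ℤ) ∣ ∑ δ ∈ N.divisors, ((N / δ : ℕ) : ℤ) * r δ)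
    (γ : SL(2, ℤ)) (hγN : (N : ℤ) ∣ γ 1 0) (hc : 0 < γ 1 0) (hd : Odd (γ 1 1)) (τ : ℍ) :
    etaQuotient N r (γ • τ) =
      (∏ δ ∈ N.divisors, ((J((δ : ℤ) | (γ 1 1).natAbs) : ℤ) : ℂ) ^ (r δ)) * ((γ 1 0 : ℂ) * τ + γ 1 1) ^ k * etaQuotient N r τ := by
  obtain ⟨cN, hcN⟩ := hγN
  have hcNpos : 0 < cN := by
    rcases lt_trichotomy cN 0 with h | h | h
    · nlinarith [hcN]
    · rw [h, mul_zero] at hcN; omega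
    · exact h
  have hcδ : ∀ δ ∈ N.divisors, γ 1 0 = δ * (cN * (N / δ : ℕ)) := fun δ hδ ↦ by
    have hNδ : ((δ : ℕ) : ℤ) * ((N / δ : ℕ) : ℤ) = N := by
      exact_mod_cast Nat.mul_div_cancel' (Nat.dvd_of_mem_divisors hδ)
    rw [hcN, ← hNδ]; ring
  have hcδpos : ∀ δ ∈ N.divisors, 0 < cN * (N / δ : ℕ) := fun δ hδ ↦
    mul_pos hcNpos (by exact_mod_cast Nat.div_pos (Nat.divisor_le hδ) (Nat.pos_of_mem_divisors hδ))
  set j : ℂ := (γ 1 0 : ℂ) * τ + γ 1 1 with hj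
  have hjne : j ≠ 0 := SL2_denom_ne_zero γ τ
  have hfactor : ∀ δ ∈ N.divisors, η (δ * ((γ • τ : ℍ) : ℂ)) =
      etaMultiplier (γ 0 0) (γ 0 1 * δ) (cN * (N / δ : ℕ)) (γ 1 1) * Complex.sqrt j * η (δ * (τ : ℂ)) := fun δ hδ ↦ by
    have hδ0 := Nat.pos_of_mem_divisors hδ
    obtain ⟨h00, h01, h10, h11⟩ := conjDelta_apply γ δ _ (hcδ δ hδ)
    have := eta_SL2_smul (conjDelta γ δ _ (hcδ δ hδ)) (Or.inl (by rw [h10]; exact hcδpos δ hδ)) (natMulPt δ hδ0 τ)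
    rw [natMul_coe_SL2_smul γ δ hδ0 _ (hcδ δ hδ), this, etaMultiplierSL, h00, h01, h10, h11, coe_natMulPt]
    congr 2
    rw [hj]
    have : ((γ 1 0 : ℤ) : ℂ) = δ * (cN * (N / δ : ℕ) : ℤ) := by exact_mod_cast hcδ δ hδ
    rw [this]; push_cast; ring
  rw [etaQuotient_apply, etaQuotient_apply, Finset.prod_congr rfl fun δ hδ ↦ by rw [hfactor δ hδ]]
  simp_rw [mul_zpow, Finset.prod_mul_distrib]
  have hsqrt : ∏ δ ∈ N.divisors, Complex.sqrt j ^ (r δ) = j ^ k := by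
    have hsne : Complex.sqrt j ≠ 0 := fun h ↦ hjne (by rw [← csqrt_sq j, h]; simp)
    rw [show (∏ δ ∈ N.divisors, Complex.sqrt j ^ (r δ)) = Complex.sqrt j ^ (∑ δ ∈ N.divisors, r δ) by
      induction N.divisors using Finset.induction_on with
      | empty => simp
      | insert a s ha ih => rw [Finset.prod_insert ha, Finset.sum_insert ha, ih, zpow_add₀ hsne],
      hk, zpow_mul, show Complex.sqrt j ^ (2 : ℤ) = j by
        rw [show (2 : ℤ) = ((2 : ℕ) : ℤ) from rfl, zpow_natCast, csqrt_sq]]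
  have hmult : ∏ δ ∈ N.divisors, etaMultiplier (γ 0 0) (γ 0 1 * δ) (cN * (N / δ : ℕ)) (γ 1 1) ^ (r δ) =
      ∏ δ ∈ N.divisors, ((J((δ : ℤ) | (γ 1 1).natAbs) : ℤ) : ℂ) ^ (r δ) := by
    rw [Finset.prod_congr rfl fun δ hδ ↦ by
      rw [etaMultiplier_of_odd_d (hcδpos δ hδ) hd, mul_zpow, ← Complex.exp_int_mul]]
    rw [Finset.prod_mul_distrib, ← Complex.exp_sum]
    have hcop : IsCoprime (γ 1 0) (γ 1 1) := by
      refine ⟨γ 1 1 * 0 + -γ 0 1, γ 0 0, ?_⟩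
      linear_combination det_entries γ
    rw [jacobi_prod_eq N r k hk (γ 1 0) (γ 1 1) ⟨cN, hcN⟩ hcop hd (fun δ ↦ cN * (N / δ : ℕ)) hcδ]
    obtain ⟨t, ht⟩ := newman_exponent_sum_dvd N r k hkeven hk h1 h2 (γ 0 0) (γ 0 1) cN (γ 1 1) hd
    rw [show (∑ δ ∈ N.divisors, (r δ : ℂ) * (π * I / 12 *
        (etaP₂ (γ 0 0) (γ 0 1 * δ) (cN * (N / δ : ℕ)) (γ 1 1) : ℤ))) = (t : ℂ) * (2 * π * I) by
      rw [show (t : ℂ) * (2 * π * I) = π * I / 12 * ((24 * t : ℤ) : ℂ) by push_cast; ring, ← ht,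
        Int.cast_sum, Finset.mul_sum]
      exact Finset.sum_congr rfl fun δ _ ↦ by push_cast; ring]
    rw [Complex.exp_int_mul_two_pi_mul_I t, mul_one]
  rw [hmult, hsqrt]

/-- **The law on all of `Γ₀(N)` at EVEN level** (then `d_γ` is odd): `f(γτ) = [∏_δ (δ/|d|)^{r_δ}]·(cτ + d)^k·f(τ)` for every `γ ∈ Γ₀(N)`
(`c < 0` via `−γ`, `|−d| = |d|`, `(−1)^k = 1`; `c = 0`: `γ = ±Tⁿ`, `d = ±1`, all symbols `1`). [cite: Newman1959] [cite: Savitt2025, Thm. 1] -/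
theorem etaQuotient_smul_jacobiProd_of_mem_Gamma0 (N : ℕ) (hN : 0 < N) (hNeven : Even N) (r : ℕ → ℤ) (k : ℤ) (hkeven : Even k)
    (hk : ∑ δ ∈ N.divisors, r δ = 2 * k)
    (h1 : (24 : ℤ) ∣ ∑ δ ∈ N.divisors, (δ : ℤ) * r δ)
    (h2 : (24 : ℤ) ∣ ∑ δ ∈ N.divisors, ((N / δ : ℕ) : ℤ) * r δ)
    {γ : SL(2, ℤ)} (hγ : γ ∈ Gamma0 N) (τ : ℍ) :
    etaQuotient N r (γ • τ) =
      (∏ δ ∈ N.divisors, ((J((δ : ℤ) | (γ 1 1).natAbs) : ℤ) : ℂ) ^ (r δ)) * ((γ 1 0 : ℂ) * τ + γ 1 1) ^ k * etaQuotient N r τ := by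
  have hNc : (N : ℤ) ∣ γ 1 0 := by
    rw [Gamma0_mem] at hγ
    exact (ZMod.intCast_zmod_eq_zero_iff_dvd _ N).mp hγ
  -- `d` is odd since `c` is even and `ad − bc = 1`
  have hdo : Odd (γ 1 1) := by
    have hce : Even (γ 1 0) := (Int.natCast_dvd_natCast.mpr (even_iff_two_dvd.mp hNeven) |>.trans hNc) |> even_iff_two_dvd.mpr
    by_contra h
    rw [Int.not_odd_iff_even] at h
    have : Even (γ 0 0 * γ 1 1 - γ 0 1 * γ 1 0) := (h.mul_left _).sub (hce.mul_left _)
    rw [det_entries] at this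
    exact Int.not_even_one this
  rcases lt_trichotomy (γ 1 0) 0 with hneg | hzero | hpos
  · -- `c < 0`: use `-γ`
    have hdo' : Odd ((-γ) 1 1) := by rw [SL_neg_apply]; exact hdo.neg
    have h := etaQuotient_SL2_smul_jacobiProd N hN r k hkeven hk h1 h2 (-γ) (by rw [SL_neg_apply]; exact hNc.neg_right)
      (by rw [SL_neg_apply]; linarith) hdo' τ
    rw [SL_neg_apply, SL_neg_apply, show (-γ) • τ = γ • τ by simp, Int.natAbs_neg] at h
    rw [h]
    push_cast
    rw [show (-(γ 1 0 : ℂ) * τ + -(γ 1 1 : ℂ)) = -((γ 1 0 : ℂ) * τ + γ 1 1) by ring, Even.neg_zpow hkeven]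
  · -- `c = 0`: `γ = ±Tⁿ`, all Jacobi symbols at `|d| = 1` are `1`
    have hdet := det_entries γ
    have hJ : ∀ (hd : (γ 1 1).natAbs = 1), (∏ δ ∈ N.divisors, ((J((δ : ℤ) | (γ 1 1).natAbs) : ℤ) : ℂ) ^ (r δ)) = 1 := fun hd ↦ by
      rw [hd]
      exact Finset.prod_eq_one fun δ _ ↦ by rw [jacobiSym.one_right]; simp
    rcases SL2Z_d_of_c_eq_zero γ hzero with hd | hd
    · have ha : γ 0 0 = 1 := by rw [hzero, hd] at hdet; linarith
      have hcoe : ((γ • τ : ℍ) : ℂ) = (τ : ℂ) + (γ 0 1 : ℤ) := by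
        rw [coe_SL2_smul, ha, hzero, hd]; push_cast; ring
      rw [etaQuotient_of_coe_eq_add_intCast N r h1 hcoe, hJ (by rw [hd]; rfl), hzero, hd]
      simp
    · have ha : γ 0 0 = -1 := by rw [hzero, hd] at hdet; linarith
      have hcoe : ((γ • τ : ℍ) : ℂ) = (τ : ℂ) + ((-γ 0 1 : ℤ) : ℂ) := by
        rw [coe_SL2_smul, ha, hzero, hd]; push_cast; ring
      rw [etaQuotient_of_coe_eq_add_intCast N r h1 hcoe, hJ (by rw [hd]; rfl), hzero, hd]
      push_cast
      rw [zero_mul, zero_add, Even.neg_one_zpow hkeven, one_mul, one_mul]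
  · exact etaQuotient_SL2_smul_jacobiProd N hN r k hkeven hk h1 h2 γ hNc hpos hdo τ

/-- **Slash form**: `f ∣_k γ = [∏_δ (δ/|d_γ|)^{r_δ}] • f` for `γ ∈ Γ₀(N)`, `N` even, `k` even. [cite: Newman1959] -/
theorem etaQuotient_slash_jacobiProd (N : ℕ) (hN : 0 < N) (hNeven : Even N) (r : ℕ → ℤ) (k : ℤ) (hkeven : Even k)
    (hk : ∑ δ ∈ N.divisors, r δ = 2 * k)
    (h1 : (24 : ℤ) ∣ ∑ δ ∈ N.divisors, (δ : ℤ) * r δ)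
    (h2 : (24 : ℤ) ∣ ∑ δ ∈ N.divisors, ((N / δ : ℕ) : ℤ) * r δ)
    {γ : SL(2, ℤ)} (hγ : γ ∈ Gamma0 N) :
    etaQuotient N r ∣[k] γ = (∏ δ ∈ N.divisors, ((J((δ : ℤ) | (γ 1 1).natAbs) : ℤ) : ℂ) ^ (r δ)) • etaQuotient N r := by
  funext τ
  have hj : ((γ 1 0 : ℂ) * τ + γ 1 1) ≠ 0 := SL2_denom_ne_zero γ τ
  rw [SL_slash_apply, ModularGroup.denom_apply, etaQuotient_smul_jacobiProd_of_mem_Gamma0 N hN hNeven r k hkeven hk h1 h2 hγ, Pi.smul_apply,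
    smul_eq_mul, zpow_neg]
  field_simp

end Summit.BirchSwinnertonDyer.BirchSwinnertonDyer.Theorems.ManinLocalTwoThree.EtaAnchor

end
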